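import Summits.QuantumFields.YangMills.Theorems.BalabanUVNodesN15VectorPieceReadoutFull
import HarnessLib

/-!
# Route «BalabanUVNodes» (K4 «SpineRates»), node N15 = NE2, -a lane, part 25: THE SIZED REALISED FAMILY — Bałaban's size parameter `M` as a
# free index, so that the BY-NAME predicates `T4EtaRate.NE2ZeroOperator` ∕ `NE2PlusOperator` for the vector single-scale piece are
# EQUIVALENT to the guard-free (3.42) content (kernel certificate of non-vacuity)

Cell `pub-ymgap`, seat `pub-ymgap-dag-n15-a` (KNIT-BY-NAME, generation g5; HUMAN RULING D-0062; chair R424 venue; `bears_on: R4∕N15`).  Filed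
`--supports stmt-QuantumFields-19676` (helper; K3 «SpineGivenEndpointR11» after the route's rev-1 re-key).  Plumbing: one index structure (`VecIndexS`) + six
definitions (`VecIndex.withSize`, `vecGeoCS`, `vecGeoFS`, `vecPairingS`, `vecInstanceS`, `vecFamilyS` — the part-17 objects with ONE field changed), then theorems.
Imports BY NAME part 23 (transitively part 17: `VecIndex`, `vecGeoC∕F`, `vecPairing`, `vecInstance`, `vecFamily`; `entry3`).  Part 24's guard-free content
`etaRateIneq342_vec_all` is NOT imported here (its hub olean is pending); the two by-name corollaries that CONCLUDE `NE2ZeroOperator`∕`NE2PlusOperator` on the sized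
family from it are a separate leaf file (part 28).

WHY.  dag-ref-B READ-323∕335 (pub-ymgap INBOX l.11681∕l.11794), vacuity audit A2: `NE2ZeroOperator` (T4EtaRate :275) and `NE2PlusOperator` (:250) open with
`∃ M₅ …, ∀ i, M₅ ≤ (pi i).gf.M → …`, and part 17's realised geometries inherit `M := 1` from `B6UnitTorusCarrier.unitTorusGeo` — so parts 17∕23's by-name
conclusions are provable with `M₅ = 2` and NO estimate.  The referee offered two repairs: (i) state the guard-free content — DONE, part 24
`etaRateIneq342_vec_all`; (ii) realise the size parameter so that `M₅ ≤ M` is LIVE.  This file does (ii) in the form g0's knit family used (`NE2NodeTorus.KnitIndex`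
carries `M` as a free real; ref-B READ #5 PASS): the index is a realised index PLUS a free `M ≥ 1`, copied into both geometries' `M` field; every other
field, the pairing and the kernel family are part 17's VERBATIM.  At `U = 1` nothing depends on `M` ([B9]'s `M` is the side of the large cubes of the regularity
condition (3.35) p.396, void on the one-point background carrier), so the estimates are uniform in it — and now the by-name predicates SAY something:
§2 proves they are EQUIVALENT to part 24's guard-free statement (`ne2ZeroOperator_vecS_iff`, `ne2PlusOperator_vecS_iff`: from the by-name statement one
RECOVERS the (3.42) inequality for every realised index by reading it at size `max M₅ 1`, with `α₀ := a₀ ∕ max M₅ 1` for NE2⁺); concluding them from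
part 24's `etaRateIneq342_vec_all` is part 28's two-liner.

HONEST FRAMING ∕ LIMITS.  Bookkeeping (types and equivalences); no estimate at all in this file.  `U = 1` LINEAR theory on FINITE tori (NE2⁰ content inside NE2⁺'s type: the «+»
block — (3.35)-regular backgrounds, `Mα₀ ≤ a₀` — is inert on the one-point carrier, exactly as said in parts 17∕23 and g0's knit); one single-scale piece in
King's (4.42) shape, NOT the multiscale carrier ∕ telescoping over `j` (NODE 00); NE2⁺ proper (U ≠ 1) NOT PRINTED ∕ not proved.  Count-neutral (typed 28∕28 ·
discharged unchanged); NOT a discharge of N15; one finite T⁴ at fixed ε — NOT infinite volume, NOT OS on ℝ⁴, NOT a mass gap, NOT Clay.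
-/

noncomputable section

namespace Summit.QuantumFields.YangMills.BalabanUVNodes.N15.VectorPiece

open Literature.MathematicalPhysics.QuantumFieldTheory.Balaban1983to89
open Literature.MathematicalPhysics.QuantumFieldTheory.Balaban1983to89.T4EtaRate (PairedInstance EtaPairing EtaRateIneq342 NE2PlusOperator
  NE2ZeroOperator)
open Literature.MathematicalPhysics.QuantumFieldTheory.Balaban1983to89.T4EtaRateDefectSite (pt9Bg)
open Literature.MathematicalPhysics.QuantumFieldTheory.Balaban1983to89.B5Prop11Plancherel (Tor fine)

variable {d : ℕ}

/-! ## §1 The sized index and the sized realised family (part 17's objects with the size field live) -/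

/-- INDEX OF THE SIZED FAMILY: a realised index of part 17 (unit torus with `L ∣ M_ν`, levels `k`, `m ≥ 1`, direction `ν`) together with Bałaban's SIZE
PARAMETER `M ≥ 1` as a free real (the estimates at `U = 1` are uniform in it). [cite: Balaban1985BackgroundPropagators, Thm 3.1 p.397 («for M ≥ M₁»: the size parameter of the quantifier template)] -/
structure VecIndexS (d L : ℕ) extends VecIndex d L where
  /-- Bałaban's size parameter `M` ([B9] p.396: the large cubes have side `O(1)·M`) -/
  Msz : ℝ
  /-- `M ≥ 1` -/
  one_le_Msz : 1 ≤ Msz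

/-- A realised index read at a given size `M ≥ 1`. [folklore] -/
def VecIndex.withSize {L : ℕ} (i : VecIndex d L) {Msz : ℝ} (h : 1 ≤ Msz) : VecIndexS d L := ⟨i, Msz, h⟩

/-- The sized index type is inhabited. [folklore] -/
theorem vecIndexS_nonempty (d L : ℕ) [NeZero L] : Nonempty (VecIndexS d L) :=
  let ⟨i⟩ := vecIndex_nonempty d L
  ⟨i.withSize le_rfl⟩

/-- The size parameter is UNBOUNDED across the family (so a guard `M₅ ≤ M` excludes nothing uniformly: it is live, not void). [folklore] -/
theorem exists_vecIndexS_size_ge (d L : ℕ) [NeZero L] (M₅ : ℝ) : ∃ j : VecIndexS d L, M₅ ≤ j.Msz :=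
  let ⟨i⟩ := vecIndex_nonempty d L
  ⟨i.withSize (le_max_right M₅ 1), le_max_left M₅ 1⟩

variable {L : ℕ} [NeZero L]

/-- THE SIZED COARSE GEOMETRY: part 17's `vecGeoC` with the size field set to the index's `M`. [cite: Balaban1985BackgroundPropagators, (3.42) p.397 (typing template)] -/
@[reducible] def vecGeoCS (j : VecIndexS d L) : B9.Geometry :=
  { vecGeoC j.toVecIndex with M := j.Msz }

/-- THE SIZED FINE GEOMETRY: part 17's `vecGeoF` with the size field set to the index's `M`. [cite: Balaban1985BackgroundPropagators, (3.42) p.397 (typing template)] -/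
@[reducible] def vecGeoFS (j : VecIndexS d L) : B9.Geometry :=
  { vecGeoF j.toVecIndex with M := j.Msz }

/-- THE η-PAIRING of the sized geometries: part 17's `vecPairing` verbatim (the size fields agree by construction). [cite: King1986, p.664 (convention before Prop. 3.8)] -/
def vecPairingS (hL : 1 ≤ L) (j : VecIndexS d L) : EtaPairing (vecGeoCS j) (vecGeoFS j) pt9Bg pt9Bg where
  n := (vecPairing hL j.toVecIndex).n
  k_eq := (vecPairing hL j.toVecIndex).k_eq
  L_eq := (vecPairing hL j.toVecIndex).L_eq
  M_eq := rfl
  eta_eq := (vecPairing hL j.toVecIndex).eta_eq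
  ι := (vecPairing hL j.toVecIndex).ι
  scale_ι := (vecPairing hL j.toVecIndex).scale_ι
  dist_ι := (vecPairing hL j.toVecIndex).dist_ι
  τ := (vecPairing hL j.toVecIndex).τ
  suppIn_τ := (vecPairing hL j.toVecIndex).suppIn_τ
  supNorm_τ := (vecPairing hL j.toVecIndex).supNorm_τ
  avg := (vecPairing hL j.toVecIndex).avg
  avg_one := (vecPairing hL j.toVecIndex).avg_one

/-- THE SIZED REALISED PAIRED-INSTANCE FAMILY of the vector single-scale piece. [cite: Balaban1985BackgroundPropagators, Thm 3.14 pp.426–427 (typing template)] -/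
def vecInstanceS (hL : 1 ≤ L) (j : VecIndexS d L) : PairedInstance :=
  ⟨vecGeoCS j, vecGeoFS j, pt9Bg, pt9Bg, vecPairingS hL j⟩

/-- THE KERNEL FAMILIES of the sized instances: part 17's `vecFamily` verbatim (same entries). [cite: Balaban1985BackgroundPropagators, (3.42) p.397 (the four sup entries: shape)] -/
def vecFamilyS (hL : 1 ≤ L)
    (T3 : ∀ i : VecIndex d L, (Tor (fine (L ^ i.k) i.Mn) × Fin (d + 1) → ℝ) →ₗ[ℝ] (Tor (fine (L ^ i.m * L ^ i.k) i.Mn) × Fin (d + 1) → ℝ))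
    (j : VecIndexS d L) : B9.KernelFamily (vecInstanceS hL j).gc (vecInstanceS hL j).Bf :=
  ⟨(vecFamily hL T3 j.toVecIndex).e, (vecFamily hL T3 j.toVecIndex).h1, (vecFamily hL T3 j.toVecIndex).e4, (vecFamily hL T3 j.toVecIndex).h2,
    (vecFamily hL T3 j.toVecIndex).l2, (vecFamily hL T3 j.toVecIndex).glob⟩

/-- The fine geometry's size field IS the index's `M` (the guard `M₅ ≤ (pi j).gf.M` reads `M₅ ≤ j.Msz`). [folklore] -/
theorem vecInstanceS_gf_M (hL : 1 ≤ L) (j : VecIndexS d L) : (vecInstanceS (d := d) hL j).gf.M = j.Msz := rfl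

/-- The coarse geometry's size field IS the index's `M`. [folklore] -/
theorem vecInstanceS_gc_M (hL : 1 ≤ L) (j : VecIndexS d L) : (vecInstanceS (d := d) hL j).gc.M = j.Msz := rfl

/-- The (3.42) inequality for the sized family at `j` IS the inequality for part 17's family at the underlying index (the size field enters nowhere). [folklore] -/
theorem etaRateIneq342_vecFamilyS_iff (hL : 1 ≤ L)
    (T3 : ∀ i : VecIndex d L, (Tor (fine (L ^ i.k) i.Mn) × Fin (d + 1) → ℝ) →ₗ[ℝ] (Tor (fine (L ^ i.m * L ^ i.k) i.Mn) × Fin (d + 1) → ℝ))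
    (j : VecIndexS d L) (B δ γ : ℝ) :
    EtaRateIneq342 (vecFamilyS hL T3 j) B δ γ () ↔ EtaRateIneq342 (vecFamily hL T3 j.toVecIndex) B δ γ () :=
  Iff.rfl

/-! ## §2 On the sized family the BY-NAME predicates are EQUIVALENT to the guard-free content (kernel certificate of non-vacuity) -/

/-- **`NE2ZeroOperator` BY NAME on the sized family ⟺ the guard-free (3.42) content for every realised index.**  (⇒) read the by-name statement at size
`max M₅ 1`; (⇐) take `M₅ = 1`. [cite: Balaban1985BackgroundPropagators, Thm 3.1 p.397 (quantifier template); King1986, Props. 3.8–3.9 (3.71)–(3.75) pp.664–665 (A = 0 model)] -/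
theorem ne2ZeroOperator_vecS_iff (hL : 1 ≤ L)
    (T3 : ∀ i : VecIndex d L, (Tor (fine (L ^ i.k) i.Mn) × Fin (d + 1) → ℝ) →ₗ[ℝ] (Tor (fine (L ^ i.m * L ^ i.k) i.Mn) × Fin (d + 1) → ℝ)) :
    NE2ZeroOperator (vecInstanceS (d := d) hL) (vecFamilyS hL T3) ↔
      ∃ B δ₀ γ₀ : ℝ, 0 < B ∧ 0 < δ₀ ∧ 0 < γ₀ ∧ ∀ i : VecIndex d L, EtaRateIneq342 (vecFamily hL T3 i) B δ₀ γ₀ () := by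
  constructor
  · rintro ⟨M₅, δ₀, B₀, γ, -, hδ₀, hB₀, hγ, H⟩
    exact ⟨B₀, δ₀, γ, hB₀, hδ₀, hγ, fun i =>
      (etaRateIneq342_vecFamilyS_iff hL T3 (i.withSize (le_max_right M₅ 1)) B₀ δ₀ γ).mp (H (i.withSize (le_max_right M₅ 1)) (le_max_left M₅ 1))⟩
  · rintro ⟨B, δ₀, γ₀, hB, hδ₀, hγ₀, H⟩
    exact ⟨1, δ₀, B, γ₀, one_pos, hδ₀, hB, hγ₀, fun j _ => (etaRateIneq342_vecFamilyS_iff hL T3 j B δ₀ γ₀).mpr (H j.toVecIndex)⟩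

/-- **`NE2PlusOperator c35` BY NAME on the sized family ⟺ the same guard-free content** (the «+» block is inert on the one-point background carrier:
(⇒) read at size `max M₅ 1` with `α₀ := a₀ ∕ max M₅ 1`, `U = 1`; (⇐) take `M₅ = a₀ = 1`). [cite: Balaban1985BackgroundPropagators, Thm 3.1 p.397 (quantifier template)] -/
theorem ne2PlusOperator_vecS_iff (hL : 1 ≤ L) (c35 : ℝ)
    (T3 : ∀ i : VecIndex d L, (Tor (fine (L ^ i.k) i.Mn) × Fin (d + 1) → ℝ) →ₗ[ℝ] (Tor (fine (L ^ i.m * L ^ i.k) i.Mn) × Fin (d + 1) → ℝ)) :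
    NE2PlusOperator c35 (vecInstanceS (d := d) hL) (vecFamilyS hL T3) ↔
      ∃ B δ₀ γ₀ : ℝ, 0 < B ∧ 0 < δ₀ ∧ 0 < γ₀ ∧ ∀ i : VecIndex d L, EtaRateIneq342 (vecFamily hL T3 i) B δ₀ γ₀ () := by
  constructor
  · rintro ⟨M₅, δ₀, a₀, B₀, γ, -, hδ₀, ha₀, hB₀, hγ, H⟩
    refine ⟨B₀, δ₀, γ, hB₀, hδ₀, hγ, fun i => ?_⟩
    have hM : 0 < max M₅ 1 := lt_of_lt_of_le one_pos (le_max_right M₅ 1)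
    have hguard : (vecInstanceS (d := d) hL (i.withSize (le_max_right M₅ 1))).gf.M * (a₀ / max M₅ 1) ≤ a₀ := by
      rw [vecInstanceS_gf_M]
      show max M₅ 1 * (a₀ / max M₅ 1) ≤ a₀
      rw [mul_div_cancel₀ a₀ hM.ne']
    exact (etaRateIneq342_vecFamilyS_iff hL T3 (i.withSize (le_max_right M₅ 1)) B₀ δ₀ γ).mp
      (H (i.withSize (le_max_right M₅ 1)) (le_max_left M₅ 1) (a₀ / max M₅ 1) (div_pos ha₀ hM) hguard () trivial)
  · rintro ⟨B, δ₀, γ₀, hB, hδ₀, hγ₀, H⟩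
    refine ⟨1, δ₀, 1, B, γ₀, one_pos, hδ₀, one_pos, hB, hγ₀, fun j _ α₀ _ _ U _ => ?_⟩
    cases U
    exact (etaRateIneq342_vecFamilyS_iff hL T3 j B δ₀ γ₀).mpr (H j.toVecIndex)

/-- CONTENT RECOVERY (the non-vacuity certificate, spelled out): from the BY-NAME `NE2ZeroOperator` on the sized family one gets the (3.42) inequality for
EVERY realised index of part 17's family, guard-free. [folklore] -/
theorem etaRateIneq342_of_ne2ZeroOperator_vecS (hL : 1 ≤ L)
    (T3 : ∀ i : VecIndex d L, (Tor (fine (L ^ i.k) i.Mn) × Fin (d + 1) → ℝ) →ₗ[ℝ] (Tor (fine (L ^ i.m * L ^ i.k) i.Mn) × Fin (d + 1) → ℝ))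
    (h : NE2ZeroOperator (vecInstanceS (d := d) hL) (vecFamilyS hL T3)) :
    ∃ B δ₀ γ₀ : ℝ, 0 < B ∧ 0 < δ₀ ∧ 0 < γ₀ ∧ ∀ i : VecIndex d L, EtaRateIneq342 (vecFamily hL T3 i) B δ₀ γ₀ () :=
  (ne2ZeroOperator_vecS_iff hL T3).mp h

end Summit.QuantumFields.YangMills.BalabanUVNodes.N15.VectorPiece

end
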